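import Summits.HodgeConjecture.HodgeConjecture.Theses.AnchorTransport
import Summits.HodgeConjecture.HodgeConjecture.Theorems.AnchorTransportVariationalHodgeCurveBase
import Literature.AlgebraicGeometry.Motives.CurveThroughTwoPointsProofs
import Literature.AlgebraicGeometry.Crystalline.BlochEsnaultKerzLifting
import Literature.AlgebraicGeometry.HodgeTheory.HodgeLocus

/-!
# Line `padic-disc-transport` — skeleton for crux `VariationalHodge` (stmt-HodgeConjecture-1076)

Crux-strategist `cstrat-stmt-HodgeConjecture-1076-p1` (WALL-BREAKER on the exhausted chain, 2026-08-17).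
Route `AnchorTransport`, crux #2
`Summit.HodgeConjecture.HodgeConjecture.Theses.AnchorTransport.VariationalHodge` (Grothendieck's
variational Hodge conjecture, global-class form; HC-sandwiched, `Disproof.lean` §1).

## Idea (lens: TRANSFER to the arithmetic sibling — Maulik–Poonen's residue-disc method, one
## codimension up, with Berthelot–Ogus' p-adic Lefschetz (1,1) replaced by the p-adic algebraization
## question of Bloch–Esnault–Kerz / Antieau–Mathew–Morrow–Nikolaus)

Every deformation-theoretic line on this crux died at the same place: a REPRESENTATIVE of the anchored
class had to deform, and at anchors whose local Hodge locus is singular (Duque–Villaflor fake linear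
cycles on the Fermat sextic fourfold) no semiregular representative of any kind exists
(`NEGATIVE-semiregularity-void-at-singular-hodge-loci.md`, `Lines/polar-patch-broken-cycles-dead.md`).
This line never chooses a representative and never deforms anything over `ℂ`. It moves ALGEBRAICITY
from the anchor fibre `X_{s₀}` to ONE fibre `X_s` that is GENERIC over a countable field of definition
`k` of the data — which suffices (STUB G, known: spreading a cycle from a `k`-generic fibre covers a
dense set of fibres, and the algebraicity locus is a countable union of closed sets) — and it reaches
such an `s` p-ADICALLY: for `p ≫ 0` of good reduction the anchor `s₀ ∈ S(k)` and uncountably many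
`W(𝔽̄_p)`-points `s` of `S` have the SAME reduction `s̄₀`; since `k̄` is countable, some such `s` is
`k`-generic. The anchor cycle `Z₀ ⊂ X_{s₀}` reduces to `Z̄₀ ⊂ X̄₀ = Y_𝔽̄ₚ`, the common special fibre of
the two `W`-models `𝒳 ×_{s₀} W` and `𝒴 := 𝒳 ×_{s} W`. The de Rham incarnation `ε` of the flat section
`t ↦ A|_{X_t}` is an ALGEBRAIC horizontal section of `(H^{2p}_dR(𝒳/S), ∇_GM)` defined over `k` (it is
the unique horizontal section through the `k`-rational value `cl_dR(Z₀)`; no absolute-Hodge input) and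
lies in `F^p` (the crux's fibrewise `(p,p)` hypothesis); by Berthelot–Ogus the crystalline–de Rham
comparison for `𝒴` carries `cl_cris(Z̄₀)` to `ε(s) ∈ F^p H^{2p}_dR(X_s/K)` — Bloch–Esnault–Kerz's
condition (a). The p-adic FORMAL half is a THEOREM (BEK 2014 Thm 1.3 for `p > d + 6`; AMMN 2022
Thm D in general): the `K₀ ⊗ ℚ`-class of `Z̄₀` lifts to a pro-class `ξ̂ ∈ (lim_n K₀(Y_n)) ⊗ ℚ` on the
`p`-adic thickenings of `𝒴`. THE BET (STUB P) is the remaining p-adic ALGEBRAIZATION, typed here with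
NO hypothesis structure, purely over the tree's real `K`-theory carriers: the image of
`(lim_n K₀(Y_n))_ℚ → K₀(Y_𝔽̄ₚ)_ℚ` is contained in the image of `K₀(𝒴)_ℚ → K₀(Y_𝔽̄ₚ)_ℚ` — by Antieau–
Mathew–Morrow–Nikolaus 2022, Theorem D (their answer to Question 1.4, "the p-adic deformation
problem": `x ∈ K₀(Y_k;ℚ)` lifts to `K₀^cts` iff `ch_crys(x)` lands in `⊕ Fil^i H^{2i}_dR`), this is the
`K₀`-form of their Conjecture 1.3 = the Fontaine–Messing / Emerton p-adic variational Hodge conjecture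
= BEK 2014 Conj. 1.2, up to the kernel of the crystalline Chern character on `K₀(Y_𝔽̄ₚ)_ℚ` (which
vanishes under Beilinson–Parshin for `Y` over `𝔽̄_p`). Given an
algebraic `η ∈ K₀(𝒴)_ℚ` with `η|_{Y_𝔽̄ₚ} = ξ̂|_{Y_𝔽̄ₚ}`, `ch_dR(η_K) = ε(s)` in degree `2p`, so `A|_{X_s}`
is algebraic at the `k`-generic point `s` (read in `ℂ` through any embedding `ι : K̄ ↪ ℂ` extending
`σ|` on the finitely generated ring of definition), and STUB G finishes. STUB D is the descent of the
crux data (over the tree's unconditional curve-base reduction) to a countable field of definition.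

Why it dodges the recorded deaths: (i) no representative is deformed — BEK/AMMN lift CLASSES, and their
lifting criterion is unobstructed exactly when the Hodge-filtration condition holds, whatever the
singularities of the Hodge locus `V_λ` in the full moduli (the Duque–Villaflor witness `(X⁴₆, λ)` is a
CONFIRMING instance: `λ` lifts pro-formally along every curve in `V_λ`); (ii) the bet is NOT
`V`-implied and NOT HC-implied ("in the p-adic setting no such implication is available", BEK 2014
§1), so — unlike every previous stub on this crux — it is independently refutable (a p-adic
counterexample kills the line without touching HC) and independently attackable (BEK 2014, AMMN 2022,
X. Hu 2025; known for divisors = Berthelot–Ogus 1983; junction with route `PadicSemiregularLift`, whose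
engine `FormalLiftingFromClassLifting` + `FormalVectorBundlesAlgebraize` is one way to prove STUB P for
semiregular seeds); (iii) the characteristic-ZERO analogue of the bet is NOT used: it is equivalent to
the crux (BEK char 0, arXiv:1310.1773, App. A: "infinitesimal Hodge ⟺ variational Hodge") and its
natural strengthening is false (App. B: `K₀(Y_{ℂ[[t]]})_ℚ → (lim K₀(Y ⊗ ℂ[t]/tⁿ))_ℚ` is not surjective
for `p_g(Y) > 0`) — recorded in `STRATEGY-CENSUS.md` §Strengthen.

Disproof used (`Cruxes/VariationalHodge/Disproof.lean`, cdisprove cycle 1): `withoutAnchor_iff_hodgeConjecture`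
— the anchor is used ESSENTIALLY (STUB S reduces the anchor CYCLE modulo `p`; no anchor, no `ξ̂`);
`withoutBaseHyps_of_hodgeConjecture` — irreducibility of `S` is used essentially (generic point,
STUB G) and smoothness through good reduction (STUB S); `hodgeConjecture_imp` — no stub is claimed
refutable on truth over `ℂ`; the bet lives over `W(𝔽̄_p)` where the sandwich does not reach. No landed
`Negative/` lemma concerns p-adic statements (`Theorems/VariationalHodge/Negative/AnchorLoadBearing.lean`
is honoured as above).

## THE FOUR STUBS (`theorem stub_<name> : <Def> := by sorry`; `sorry` nowhere else)

* D `stub_descent` — `VariationalHodgeDescended → CurveResidual`: the crux over smooth irreducible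
  affine curve bases (the residual form of `Theorems.variationalHodge_of_curveBase`) follows from the
  same statement for families `(baseChangeHom σ).map f₀` base-changed from a COUNTABLE field `k` along
  `σ : k →+* ℂ` (EGA IV 8.8.2: the finitely presented data `f` descend to a finitely generated subfield;
  transport of the hypotheses and of `algebraicClasses` along the isomorphism of families —
  `AnchorTransport.IsoInvariance`, proved). Size M/L. Provable now.
* G `stub_genericPropagation` — algebraicity of `A|_{X_s}` at ONE `k`-GENERIC complex point `s`
  (`IsGenericPoint`: `s` lies in no proper subset of `S(ℂ)` defined over `σ(k)`,
  `HodgeTheory.IsDefinedOver`) implies algebraicity at every complex point. The shape of route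
  `PadicSemiregularLift`'s support `HodgeLocusPropagation` (stmt-HodgeConjecture-14977) with `ℚ̄`
  replaced by `k` (spread the cycles from the generic fibre over a variety dominating `S₀`; classes of a
  flat family are locally constant; the algebraicity locus is a countable union of closed subsets —
  Voisin 2007 §1 / Charles–Schnell Prop. 11.3.x; on a curve a dense such union is everything). Size L.
  Known in print.
* P `stub_padicImageAlgebraization` — THE BET (hardest, research-open): `PadicImageAlgebraization`.
  For every `d` there is `p₀` such that for all primes `p ≥ p₀`, every algebraically closed field `κ`
  algebraic over `𝔽_p`, every smooth proper model `𝒴/W(κ)` of relative dimension `d`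
  (`WittScheme.IsSmoothProperModel`) and every pro-class `ξ̂ ∈ (lim_n K₀(𝒴 ⊗ W/p^{n+1})) ⊗ ℚ`
  (`KTheory.ContinuousKZeroRat`), the restriction `ξ̂|_{Y_κ} ∈ K₀(Y_κ)_ℚ` is the restriction of an
  algebraic class `η ∈ K₀(𝒴)_ℚ`. = AMMN 2022 Conj. 1.3 in `K₀`-form (given their Thm D answering
  Question 1.4); BEK 2014 Conj. 1.2 (Fontaine–Messing); Emerton. Known: for line-bundle classes
  (Berthelot–Ogus 1983, BEK §1 (1.1)–(1.3)); the FORMAL half for all classes (BEK Thm 1.3, AMMN Thm D). The `p₀` valve and `κ` algebraic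
  over `𝔽_p` (Beilinson–Parshin: `CH(Y_κ)_ℚ ↪ H`) are the weakest forms the composition needs.
* S `stub_arithmeticDiscSupply` — THE BRIDGE (X-sized classical arithmetic geometry, Maulik–Poonen
  2012 pattern): for descended data and an anchor `s₀` and any bound `N`, there exist a prime `q ≥ N`,
  `κ` as above, a smooth proper model `𝒴/W(κ)` of relative dimension `n`, a pro-class `ξ̂` on it, a
  `k`-GENERIC complex point `s` and an embedding `ι : K(q,κ) →+* ℂ` with `𝒴_K ⊗_ι ℂ ≅ X_s`, such that
  algebraizability of `ξ̂|_{Y_κ}` (the conclusion of STUB P for `𝒴, ξ̂`) implies `A|_{X_s}` algebraic.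
  Intended witness: a finitely generated `ℤ`-model `𝒳_R → S_R` (EGA IV.8), `q ≫ 0` with an
  `R → W(𝔽̄_q)` point (Cassels / Hensel), `s ∈ S_R(W)` generic in the residue disc of `s₀`,
  `𝒴 := 𝒳_R ×_s W`, `ξ̂` := the AMMN-Thm-D lift of the `K₀`-class of the reduction `Z̄₀` (Hodge
  condition (a) from Berthelot–Ogus horizontal transport of the `k`-rational algebraic flat section `ε`
  and the crux's `(p,p)` hypothesis), and `ch_dR(η_K) = ε(s)` read through `ι` (Riemann–Roch without
  denominators to place the class in degree `p` only). Its proof decomposes into named-fact-sized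
  supports: (s1) integral models + `W`-points; (s2) `Crystalline.BlochEsnaultKerzLifting` / AMMN Thm D
  over a `CrystallineRealization`; (s3) B–O transport across a residue disc; (s4) cycle specialization
  (Fulton §20.3) and dR/Betti comparison of Chern characters (`StandardChernCharacterBetti`); (s5) field
  embeddings `K̄ ↪ ℂ` extending a finitely generated isomorphism (Mathlib
  `IsAlgClosed`/transcendence bases).

Composition (no `sorry`): `variationalHodgeDescended_of : G → P → S → VariationalHodgeDescended`
(choose `p₀ := P n`, feed it as the bound `N` of S, apply P to the supplied `(𝒴, ξ̂)`, then G at the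
generic point), and `VariationalHodge_of : D → G → P → S → VariationalHodge` through
`Theorems.variationalHodge_of_curveBase mumford_smoothCurve_through_two_points_holds` — the conclusion
is LITERALLY the route decl, no residual / passenger stub (no quasi-projectivity case split: the bet is
stated for smooth PROPER models).
-/

noncomputable section

set_option linter.dupNamespace false

open CategoryTheory AlgebraicGeometry TopologicalSpace
open Literature.AlgebraicGeometry.Motives Literature.AlgebraicGeometry.HodgeTheory
open Literature.AlgebraicGeometry.KTheory Literature.AlgebraicGeometry.Crystalline
open Summit.HodgeConjecture.HodgeConjecture.Theses.AnchorTransport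
open Summit.HodgeConjecture.HodgeConjecture.Theorems
open scoped Isocrystal

namespace Summit.HodgeConjecture.HodgeConjecture.Cruxes.VariationalHodge.PadicDiscTransport

/-! ## §1 The residual crux over curve bases and its descended form -/

/-- The crux over smooth irreducible AFFINE CURVE bases — verbatim the hypothesis `h` of the tree's
unconditional reduction `Theorems.variationalHodge_of_curveBase` (Mumford's curve lemma discharged:
`mumford_smoothCurve_through_two_points_holds`). [cite: CharlesSchnell2014Notes, Conj. 11.3.1] -/
def CurveResidual : Prop :=
  ∀ ⦃n : ℕ⦄ ⦃𝒳 S : SchemeOver ℂ⦄ (f : 𝒳 ⟶ S), IsSmoothProjectiveFamily f n →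
    IrreducibleSpace S.left → IsAffine S.left → AlgebraicGeometry.Smooth S.hom →
    topologicalKrullDim S.left = 1 →
    ∀ (p : ℕ) (A : complexBetti 𝒳 (2 * p)),
    (∀ s : ComplexPoints S, IsRationalClass (complexBetti.map (fiberι f s) (2 * p) A) ∧
      IsOfHodgeType n (fiberOver f s) (2 * p) p p (complexBetti.map (fiberι f s) (2 * p) A)) →
    (∃ s₀ : ComplexPoints S,
      complexBetti.map (fiberι f s₀) (2 * p) A ∈ algebraicClasses (fiberOver f s₀) p) →
    ∀ s : ComplexPoints S,
      complexBetti.map (fiberι f s) (2 * p) A ∈ algebraicClasses (fiberOver f s) p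

/-- A complex point `s` of the complexification `S = S₀ ⊗_{k,σ} ℂ` of a `k`-scheme is **`k`-GENERIC**:
it lies in no proper subset of `S(ℂ)` defined over `σ(k)` in Weil's sense (`HodgeTheory.IsDefinedOver`:
Zariski closed and stable under `Aut(ℂ/σk)`). For an irreducible curve and countable `k`: `s` is not
algebraic over `σ(k)`, i.e. `Spec ℂ → S₀` hits the generic point. [cite: Lang1958IAG, Ch. III §5] -/
def IsGenericPoint (k : Type) [Field k] (σ : k →+* ℂ) {S₀ : SchemeOver k}
    (s : ComplexPoints ((baseChangeHom σ).obj S₀)) : Prop :=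
  ∀ Z : Set (ComplexPoints ((baseChangeHom σ).obj S₀)),
    IsDefinedOver σ S₀ σ.fieldRange Z → s ∈ Z → Z = Set.univ

/-- **The crux for DESCENDED data**: `CurveResidual` for families `(baseChangeHom σ).map f₀` obtained
by base change along `σ : k →+* ℂ` from a COUNTABLE field `k` (all hypotheses and the conclusion read
on the complexification, exactly as in `CurveResidual`). [cite: CharlesSchnell2014Notes, Conj. 11.3.1] -/
def VariationalHodgeDescended : Prop :=
  ∀ (k : Type) [Field k] [Countable k] (σ : k →+* ℂ) ⦃n : ℕ⦄ ⦃𝒳₀ S₀ : SchemeOver k⦄ (f₀ : 𝒳₀ ⟶ S₀),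
    IsSmoothProjectiveFamily ((baseChangeHom σ).map f₀) n →
    IrreducibleSpace ((baseChangeHom σ).obj S₀).left → IsAffine ((baseChangeHom σ).obj S₀).left →
    AlgebraicGeometry.Smooth ((baseChangeHom σ).obj S₀).hom →
    topologicalKrullDim ((baseChangeHom σ).obj S₀).left = 1 →
    ∀ (p : ℕ) (A : complexBetti ((baseChangeHom σ).obj 𝒳₀) (2 * p)),
    (∀ s : ComplexPoints ((baseChangeHom σ).obj S₀),
      IsRationalClass (complexBetti.map (fiberι ((baseChangeHom σ).map f₀) s) (2 * p) A) ∧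
      IsOfHodgeType n (fiberOver ((baseChangeHom σ).map f₀) s) (2 * p) p p
        (complexBetti.map (fiberι ((baseChangeHom σ).map f₀) s) (2 * p) A)) →
    (∃ s₀ : ComplexPoints ((baseChangeHom σ).obj S₀),
      complexBetti.map (fiberι ((baseChangeHom σ).map f₀) s₀) (2 * p) A ∈
        algebraicClasses (fiberOver ((baseChangeHom σ).map f₀) s₀) p) →
    ∀ s : ComplexPoints ((baseChangeHom σ).obj S₀),
      complexBetti.map (fiberι ((baseChangeHom σ).map f₀) s) (2 * p) A ∈
        algebraicClasses (fiberOver ((baseChangeHom σ).map f₀) s) p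

/-! ## §2 The four stub statements -/

/-- **STUB D — descent to a countable field of definition.** The residual crux over smooth irreducible
affine curves follows from its descended form: `f : 𝒳 ⟶ S` is of finite presentation over `ℂ`, hence
isomorphic (over `ℂ`) to `(baseChangeHom σ).map f₀` for a finitely generated — so countable — subfield
`k = σ(k) ⊂ ℂ` (EGA IV, Thm. 8.8.2); the hypotheses are invariant under isomorphism of families and so is
the conclusion (`AnchorTransport.IsoInvariance`, proved: `IsoInvariance_holds`).
[cite: EGAIV3, Thm. 8.8.2] -/
def Descent : Prop :=
  VariationalHodgeDescended → CurveResidual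

/-- **STUB G — propagation from a `k`-generic fibre** (known; the shape of
`PadicSemiregularLift.HodgeLocusPropagation` with `ℚ̄` replaced by an arbitrary countable `k`): for a
smooth projective family base-changed from `k` over a smooth irreducible affine curve, a global class
`A` algebraic on the fibre over ONE `k`-generic complex point is algebraic on every fibre (spread the
cycles of the generic fibre over a variety dominating `S₀`; classes of flat families are locally
constant, so `A` is algebraic on a dense set of fibres; the algebraicity locus is a countable union of
Zariski-closed subsets — for each finite family of relative Hilbert components a union of connected
components of their fibre product, with closed image — and on an irreducible curve a dense such union is
everything). [cite: Voisin2007HodgeLoci, §1 (Lemma 1.4)] [cite: CharlesSchnell2014Notes, §11.3.2] -/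
def GenericPropagation : Prop :=
  ∀ (k : Type) [Field k] [Countable k] (σ : k →+* ℂ) ⦃n : ℕ⦄ ⦃𝒳₀ S₀ : SchemeOver k⦄ (f₀ : 𝒳₀ ⟶ S₀),
    IsSmoothProjectiveFamily ((baseChangeHom σ).map f₀) n →
    IrreducibleSpace ((baseChangeHom σ).obj S₀).left → IsAffine ((baseChangeHom σ).obj S₀).left →
    AlgebraicGeometry.Smooth ((baseChangeHom σ).obj S₀).hom →
    topologicalKrullDim ((baseChangeHom σ).obj S₀).left = 1 →
    ∀ (p : ℕ) (A : complexBetti ((baseChangeHom σ).obj 𝒳₀) (2 * p))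
      (s : ComplexPoints ((baseChangeHom σ).obj S₀)), IsGenericPoint k σ s →
    complexBetti.map (fiberι ((baseChangeHom σ).map f₀) s) (2 * p) A ∈
        algebraicClasses (fiberOver ((baseChangeHom σ).map f₀) s) p →
    ∀ t : ComplexPoints ((baseChangeHom σ).obj S₀),
      complexBetti.map (fiberι ((baseChangeHom σ).map f₀) t) (2 * p) A ∈
        algebraicClasses (fiberOver ((baseChangeHom σ).map f₀) t) p

/-- **The conclusion of the p-adic algebraization question for one model and one pro-class**:
`ξ̂|_{Y_κ}` (restriction of the pro-class `ξ̂ ∈ (lim_n K₀(𝒴 ⊗ W/p^{n+1}))_ℚ` to the special fibre,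
pulled back along the canonical isomorphism `𝒴 ⊗_W κ ⟶ 𝒴 ⊗_W W/p`, `Crystalline.specialFibreToTower`)
is the restriction of an ALGEBRAIC class `η ∈ K₀(𝒴)_ℚ` (pull-back along `Y_κ ⟶ 𝒴`,
`WittScheme.specialFibreι`). [cite: AntieauMathewMorrowNikolaus2022, Conj. 1.3 and Question 1.4]
[cite: BlochEsnaultKerz2014pAdic, §1 (the algebraization arrow)] -/
def ProClassAlgebraizes {p : ℕ} [Fact p.Prime] {κ : Type} [Field κ] [CharP κ p]
    (𝒴 : SchemeOver (WittVector p κ))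
    (ξ : ContinuousKZeroRat (Ideal.span {(p : WittVector p κ)}) 𝒴) : Prop :=
  ∃ η : KZeroRat 𝒴.left,
    KZeroRat.map (WittScheme.specialFibreι 𝒴) η =
      KZeroRat.map (specialFibreToTower 𝒴)
        (ContinuousKZeroRat.specialFibre (Ideal.span {(p : WittVector p κ)}) 𝒴 ξ)

/-- **STUB P — THE BET: p-adic algebraization of rational pro-`K₀`-classes (image form).** For every
`d` there is `p₀` such that for every prime `p ≥ p₀`, every algebraically closed field `κ` of
characteristic `p` algebraic over `𝔽_p` (so `κ ≅ 𝔽̄_p`, perfect), every smooth proper model `𝒴/W(κ)`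
of relative dimension `d` with smooth projective geometrically integral fibres
(`WittScheme.IsSmoothProperModel d 𝒴`) and every `ξ̂ ∈ (lim_n K₀(𝒴 ⊗ W/p^{n+1})) ⊗ ℚ`:
`Im((lim_n K₀(Y_n))_ℚ → K₀(Y_κ)_ℚ) ∋ ξ̂|_{Y_κ}` lies in `Im(K₀(𝒴)_ℚ → K₀(Y_κ)_ℚ)`.
This is the `K₀`-form of Antieau–Mathew–Morrow–Nikolaus 2022, Conjecture 1.3 (Fontaine–Messing's
p-adic variational Hodge conjecture = Bloch–Esnault–Kerz 2014 Conj. 1.2, rational form): by their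
Theorem D — the answer to their Question 1.4, "the p-adic deformation problem": for any proper smooth
`X/𝒪_K`, `x ∈ K₀(X_k; ℚ)` lifts to `K₀^cts(X; ℚ) = π₀(lim_n K(X/πⁿ))_ℚ` (whose image in `K₀(X_k)_ℚ` is
that of `(lim_n K₀(X_n))_ℚ`) iff `ch_crys(x)` is carried into `⊕ Fil^i H^{2i}_dR(X_K/K)` — the
pro-classes are exactly the lifts of the classes satisfying condition (a), and Conj. 1.3 asserts that
those come from `K₀(X;ℚ)` up to the Chern character; the statement below is that on the nose in
`K₀(Y_κ)_ℚ`, i.e. up to `ker(ch_crys ⊗ ℚ)` (zero under Beilinson–Parshin for `κ` algebraic over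
`𝔽_p`). OPEN ("since `K(X) → K^cts(X)` is generally not an equivalence, the p-adic deformation problem
does not imply [Conj. 1.3]", AMMN §1); NOT known to follow from the Hodge conjecture (BEK §1); TRUE for
line-bundle classes (Berthelot–Ogus 1983, BEK §1 (1.1)–(1.3)). The `p₀`
valve (only primes `≫ d` are ever used by STUB S) and the restriction to `κ ≅ 𝔽̄_p` are deliberate
weakenings. [cite: AntieauMathewMorrowNikolaus2022, Conj. 1.3, Question 1.4, Thm. D]
[cite: BlochEsnaultKerz2014pAdic, Conj. 1.2, Thm. 1.3] [cite: BerthelotOgus1983, Thm. 3.8] -/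
def PadicImageAlgebraization : Prop :=
  ∀ d : ℕ, ∃ p₀ : ℕ, ∀ (p : ℕ) [Fact p.Prime], p₀ ≤ p →
    ∀ (κ : Type) [Field κ] [CharP κ p] [PerfectRing κ p] [IsAlgClosed κ] [Algebra (ZMod p) κ],
    Algebra.IsAlgebraic (ZMod p) κ →
    ∀ (𝒴 : SchemeOver (WittVector p κ)), WittScheme.IsSmoothProperModel d 𝒴 →
    ∀ ξ : ContinuousKZeroRat (Ideal.span {(p : WittVector p κ)}) 𝒴, ProClassAlgebraizes 𝒴 ξ

/-- **STUB S — the ARITHMETIC DISC (Maulik–Poonen pattern): supply of a p-adic model of a `k`-GENERIC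
fibre whose pro-class, once algebraized, makes `A` algebraic there.** For descended crux data over a
smooth irreducible affine curve, the crux's fibrewise rational-`(p,p)` hypothesis, an anchor `s₀` with
`A|_{X_{s₀}}` algebraic and any bound `N`: there are a prime `q ≥ N`, an algebraically closed field `κ`
algebraic over `𝔽_q`, a smooth proper model `𝒴/W(κ)` of relative dimension `n`, a pro-class `ξ̂` on its
`q`-adic tower, a `k`-generic complex point `s` and an embedding `ι : K = W(κ)[1/q] →+* ℂ` identifying
the generic fibre `𝒴_K ⊗_ι ℂ` with `X_s`, such that: if `ξ̂|_{Y_κ}` is the restriction of an algebraic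
class on `𝒴` then `A|_{X_s}` is algebraic. Intended construction: finitely generated `ℤ`-model
`𝒳_R → S_R ∋ s₀, Z₀` (EGA IV.8); `q ≫ 0` and `R → W(𝔽̄_q)` (Cassels' embedding + Hensel lifting of an
`𝔽̄_q`-point of the smooth `ℤ[1/M]`-scheme `Spec R`); `s ∈ S_R(W)` with `s ≡ s₀ (mod q)` and `s`
transcendental over `k` (the residue disc is uncountable, `k̄` countable); `𝒴 := 𝒳_R ×_{S_R,s} W`, whose
special fibre is that of `𝒳_R ×_{s₀} W` and carries the reduction `Z̄₀`; the algebraic horizontal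
section `ε` of `H^{2p}_dR(𝒳/S)` through `cl_dR(Z₀)` is `k`-rational and lies in `F^p` (crux hypothesis),
and Berthelot–Ogus' comparison for `𝒴` is parallel transport along the disc, so
`Φ⁻¹ cl_cris(Z̄₀) = ε(s) ∈ F^p H^{2p}_dR(𝒴_K/K)` — BEK's condition (a) for the `K₀ ⊗ ℚ`-class of `Z̄₀`
placed in degree `p` by Riemann–Roch — whence `ξ̂` by BEK Thm 1.3 / AMMN Thm D; an algebraic `η` with
`η|_{Y_κ} = ξ̂|_{Y_κ}` has `ch_p^dR(η_K) = ε(s)`, i.e. (through `ι` and the dR/Betti comparison of Chern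
characters) `A|_{X_s} ∈ ℂ·{ch_p}` = `algebraicClasses`. Size XL; its supports (s1)–(s5) are listed in the
module docstring. [cite: MaulikPoonen2012, §3–4 (p-adic disc argument)]
[cite: BerthelotOgus1983, Thm. 2.4, (2.9), Thm. 3.8] [cite: BlochEsnaultKerz2014pAdic, Thm. 1.3]
[cite: AntieauMathewMorrowNikolaus2022, Thm. D] [cite: EGAIV3, Thm. 8.8.2] -/
def ArithmeticDiscSupply : Prop :=
  ∀ (N : ℕ) (k : Type) [Field k] [Countable k] (σ : k →+* ℂ) ⦃n : ℕ⦄ ⦃𝒳₀ S₀ : SchemeOver k⦄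
    (f₀ : 𝒳₀ ⟶ S₀),
    IsSmoothProjectiveFamily ((baseChangeHom σ).map f₀) n →
    IrreducibleSpace ((baseChangeHom σ).obj S₀).left → IsAffine ((baseChangeHom σ).obj S₀).left →
    AlgebraicGeometry.Smooth ((baseChangeHom σ).obj S₀).hom →
    topologicalKrullDim ((baseChangeHom σ).obj S₀).left = 1 →
    ∀ (p : ℕ) (A : complexBetti ((baseChangeHom σ).obj 𝒳₀) (2 * p)),
    (∀ s : ComplexPoints ((baseChangeHom σ).obj S₀),
      IsRationalClass (complexBetti.map (fiberι ((baseChangeHom σ).map f₀) s) (2 * p) A) ∧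
      IsOfHodgeType n (fiberOver ((baseChangeHom σ).map f₀) s) (2 * p) p p
        (complexBetti.map (fiberι ((baseChangeHom σ).map f₀) s) (2 * p) A)) →
    ∀ s₀ : ComplexPoints ((baseChangeHom σ).obj S₀),
      complexBetti.map (fiberι ((baseChangeHom σ).map f₀) s₀) (2 * p) A ∈
        algebraicClasses (fiberOver ((baseChangeHom σ).map f₀) s₀) p →
    ∃ (q : ℕ) (_ : Fact q.Prime) (κ : Type) (_ : Field κ) (_ : CharP κ q) (_ : PerfectRing κ q)
      (_ : IsAlgClosed κ) (_ : Algebra (ZMod q) κ) (_ : Algebra.IsAlgebraic (ZMod q) κ)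
      (𝒴 : SchemeOver (WittVector q κ))
      (ξ : ContinuousKZeroRat (Ideal.span {(q : WittVector q κ)}) 𝒴)
      (s : ComplexPoints ((baseChangeHom σ).obj S₀)) (ι : K(q, κ) →+* ℂ),
      N ≤ q ∧ WittScheme.IsSmoothProperModel n 𝒴 ∧ IsGenericPoint k σ s ∧
      Nonempty ((baseChangeHom ι).obj (WittScheme.genericFibre 𝒴) ≅
        fiberOver ((baseChangeHom σ).map f₀) s) ∧
      (ProClassAlgebraizes 𝒴 ξ →
        complexBetti.map (fiberι ((baseChangeHom σ).map f₀) s) (2 * p) A ∈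
          algebraicClasses (fiberOver ((baseChangeHom σ).map f₀) s) p)

/-! ## §3 Registered stubs (`sorry` lives ONLY in these four theorems) -/

/-- STUB D (descent to a countable field; provable now, size M/L). -/
theorem stub_descent : Descent := by
  sorry

/-- STUB G (propagation from a generic fibre; known in print, size L). -/
theorem stub_genericPropagation : GenericPropagation := by
  sorry

/-- STUB P (THE BET: p-adic image algebraization, AMMN Question 1.4; research-open). -/
theorem stub_padicImageAlgebraization : PadicImageAlgebraization := by
  sorry

/-- STUB S (the arithmetic disc; classical, size XL with supports (s1)–(s5)). -/
theorem stub_arithmeticDiscSupply : ArithmeticDiscSupply := by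
  sorry

/-! ### Name-keyed aliases (the skeleton audit matches a hypothesis head to a declared stub by its last
name component) -/
namespace Registered

/-- Alias keyed by the registered stub name. -/
abbrev stub_descent : Prop := Descent
/-- Alias keyed by the registered stub name. -/
abbrev stub_genericPropagation : Prop := GenericPropagation
/-- Alias keyed by the registered stub name. -/
abbrev stub_padicImageAlgebraization : Prop := PadicImageAlgebraization
/-- Alias keyed by the registered stub name. -/
abbrev stub_arithmeticDiscSupply : Prop := ArithmeticDiscSupply

end Registered

/-! ## §4 Composition (no `sorry` below this line) -/

section Composition

/-- **G + P + S ⇒ the descended crux.** Take the bet's bound `p₀` for relative dimension `n`; the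
arithmetic disc supplies `q ≥ p₀`, a model `𝒴`, a pro-class `ξ̂` and a `k`-generic point `s`; the bet
algebraizes `ξ̂|_{Y_κ}`, so `A|_{X_s}` is algebraic; propagation from the generic fibre gives every
fibre. [cite: MaulikPoonen2012, §3–4] -/
theorem variationalHodgeDescended_of (hG : Registered.stub_genericPropagation)
    (hP : Registered.stub_padicImageAlgebraization) (hS : Registered.stub_arithmeticDiscSupply) :
    VariationalHodgeDescended := by
  intro k _ _ σ n 𝒳₀ S₀ f₀ hf hirr haff hsm hdim p A hA hs₀ t
  obtain ⟨s₀, hs₀⟩ := hs₀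
  obtain ⟨p₀, hp₀⟩ := hP n
  obtain ⟨q, hq, κ, hκF, hκC, hκP, hκA, hκAlg, hκalg, 𝒴, ξ, s, ι, hNq, h𝒴, hgen, -, himp⟩ :=
    hS p₀ k σ f₀ hf hirr haff hsm hdim p A hA s₀ hs₀
  have halg : complexBetti.map (fiberι ((baseChangeHom σ).map f₀) s) (2 * p) A ∈
      algebraicClasses (fiberOver ((baseChangeHom σ).map f₀) s) p :=
    himp (hp₀ q hNq κ hκalg 𝒴 h𝒴 ξ)
  exact hG k σ f₀ hf hirr haff hsm hdim p A s hgen halg t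

/-- **THE COMPOSITION.** `VariationalHodge` from the four stubs: reduce unconditionally to smooth
irreducible affine CURVE bases (`Theorems.variationalHodge_of_curveBase` with the discharged Mumford
fact `mumford_smoothCurve_through_two_points_holds`), descend to a countable field (D), and conclude by
`variationalHodgeDescended_of` (G, P, S). The conclusion is the route decl BY NAME; no residual stub.
[cite: CharlesSchnell2014Notes, Conj. 11.3.1] -/
theorem VariationalHodge_of (hD : Registered.stub_descent) (hG : Registered.stub_genericPropagation)
    (hP : Registered.stub_padicImageAlgebraization) (hS : Registered.stub_arithmeticDiscSupply) :
    VariationalHodge :=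
  variationalHodge_of_curveBase mumford_smoothCurve_through_two_points_holds
    (hD (variationalHodgeDescended_of hG hP hS))

/-- Wiring check: the registered stubs feed the composition as stated (this theorem depends on the four
`sorry`s and on nothing else). -/
theorem variationalHodge_holds_of_stubs : VariationalHodge :=
  VariationalHodge_of stub_descent stub_genericPropagation stub_padicImageAlgebraization
    stub_arithmeticDiscSupply

end Composition

end Summit.HodgeConjecture.HodgeConjecture.Cruxes.VariationalHodge.PadicDiscTransport

end
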